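import Mathlib.NumberTheory.NumberField.Basic
import Literature.NumberTheory.DiophantineGeometry.FunctionFieldGenus
import HarnessLib

/-!
# A `(p, q, r)` Belyi map over a number field (Darmon–Granville 1995, Prop. 3.1) — the named fact

Topic `Literature/NumberTheory/DiophantineGeometry`. ONE named fact (D-0014), no proofs:
`exists_belyiMap_of_hyperbolic_signature`, VERBATIM the hypothesis binder `hCover` of the accepted
reduction `Literature.NumberTheory.DiophantineGeometry.darmonGranville1995_thm_2_of_belyiMap_of_faltings`
(`AbcDarmonGranvilleBelyiMapReduction.lean`) — librarian sweep g24, vend-from-binder, promote event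
3396708 (the provefact seat of `darmonGranville1995_thm_2`, 6 sessions, may not mint it,
`lint.fact-fanout`). First consumer: that reduction, whence
`darmonGranville1995_thm_2_holds := …_of_belyiMap_of_faltings exists_belyiMap_of_hyperbolic_signature_holds
  ‹Faltings›` once Faltings' theorem in the tree's function-field form
(`finite_ratPlaces_of_two_le_genus`, an existing named fact) is available.

## Source and reading

Darmon–Granville, *On the equations `zᵐ = F(x, y)` and `Axᵖ + Byq = Czʳ`*, Bull. LMS 27 (1995),
Prop. 3.1 (p. 525): for hyperbolic `(p, q, r)` (`1/p + 1/q + 1/r < 1`) there is a Galois covering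
`X → ℙ¹` of signature `(p, q, r)` — ramified only above `0, 1, ∞` with ramification indices exactly
`p, q, r` — defined over a number field; proof: the Riemann existence theorem gives such a covering
over `ℂ` for a finite quotient of the triangle group (Fox's theorem supplies the finite quotient
with torsion-free kernel), and it descends to `ℚ̄`, hence to a number field. Bombieri–Gubler,
*Heights*, Cor. 12.6.7 and 12.6.8 (first sentence) record the same existence. Function-field form
over the tree's vocabulary (`FunctionFieldGenus.lean`, `FunctionFieldDivisors.lean`): a number field
`K`, an algebraic function field `F/K` with `K` integrally closed in `F` (full constant field) and
`f ∈ F ∖ K` whose zeros all have order `p`, the zeros of `f − 1` all have order `q`, the poles all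
have order `r`, and `F/K(f)` is unramified above every other closed point of the affine `f`-line
(for monic irreducible `π₀ ∉ {X, X − 1}`, `aeval f π₀` has only simple zeros). No Galois or
rational-fibre clause is needed by the consumer.

What is deliberately NOT here: the Riemann existence theorem, Fox's theorem, descent — each is
theory-sized; the genus bound `g ≥ 2` for such `F` is PROVED in the tree
(`two_le_genus_of_hyperbolic_signature`).
-/

noncomputable section

open scoped Polynomial NumberField

namespace Literature.NumberTheory.DiophantineGeometry

open Polynomial AlgFunctionField

/-- **A Belyi map of hyperbolic signature `(p, q, r)` over a number field (Darmon–Granville 1995,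
Prop. 3.1; Bombieri–Gubler Cor. 12.6.7/12.6.8).** For all `p q r : ℕ` with `qr + rp + pq < pqr`
there are a number field `K`, an algebraic function field `F/K` with `K` integrally closed in `F`,
and `f ∈ F` not constant (`f ∉ K`) such that every zero of `f` has order exactly `p`
(`0 < P.ord f → P.ord f = p`), every zero of `f − 1` has order exactly `q`, every pole of `f` has
order exactly `r` (`P.ord f < 0 → P.ord f = −r`), and above every monic irreducible
`π₀ ∈ K[X]` other than `X`, `X − 1` the function `π₀(f)` has only simple zeros (the extension
`F/K(f)` is unramified away from `0, 1, ∞`) — Riemann existence + Fox + descent to `ℚ̄`.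
VERBATIM the binder `hCover` of `darmonGranville1995_thm_2_of_belyiMap_of_faltings`; users take
`(hCover : exists_belyiMap_of_hyperbolic_signature)`. Named fact (D-0014), not proved in the tree.
[cite: DarmonGranville1995, Prop. 3.1 (p. 525) and its proof]
[cite: BombieriGubler2006, Cor. 12.6.7 and Cor. 12.6.8 (first sentence)] -/
def exists_belyiMap_of_hyperbolic_signature : Prop :=
  ∀ p q r : ℕ, q * r + r * p + p * q < p * q * r →
    ∃ (K : Type) (_ : Field K) (_ : NumberField K) (F : Type) (_ : Field F) (_ : Algebra K F)
      (_ : IsAlgFunctionField K F) (_ : IsIntegrallyClosedIn K F) (f : F),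
      f ∉ Set.range (algebraMap K F) ∧
      (∀ P : PlaceOver K F, 0 < P.ord f → P.ord f = p) ∧
      (∀ P : PlaceOver K F, 0 < P.ord (f - 1) → P.ord (f - 1) = q) ∧
      (∀ P : PlaceOver K F, P.ord f < 0 → P.ord f = -r) ∧
      (∀ π₀ : K[X], Irreducible π₀ → π₀.Monic → π₀ ≠ X → π₀ ≠ X - 1 →
        ∀ P : PlaceOver K F, 0 < P.ord (aeval f π₀) → P.ord (aeval f π₀) = 1)

end Literature.NumberTheory.DiophantineGeometry

end
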